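import Literature.Geometry.Lorentzian.KerrSchildWaveOperatorWKB
import Literature.Geometry.Lorentzian.KerrSchildEnergyCurrent
import HarnessLib

/-!
# The `T(dt, dt)`-energy density of the real part of a Gaussian beam: pointwise algebra
(trunk G08 = T-LORENTZ, geometric optics; namespace `Literature.Geometry.Lorentzian.GaussianBeam`)

Sbierski, Anal. PDE 8 (2015), §4, proof of the theorem (= arXiv:1311.2477v2 §2.3, p. 16):
"`J^N(u_λ) · n = Re(N u_λ · (n u_λ)‾) − ½ g(N, n) du_λ · (du_λ)‾ = λ² |a|² Nφ₁ · nφ₁ e^{-2λφ₂} +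
λ² |a|² Nφ₂ · nφ₂ e^{-2λφ₂} + O(λ) e^{-2λφ₂} − ½ g(N, n)[…]`", together with the third remark
after that theorem: for **real-valued** beams `Re u_λ` "the result also holds true […] only the
computations become a bit longer, since we have to deal with more terms" — the additional terms
being the oscillatory ones `Re(e^{2iλφ} …)`.

This file does that pointwise bookkeeping for the density
`P⁰[w] = T^{00}[w] = (∑ G^{0ν} ∂_νw)² − ½ G^{00} ∑ G^{αβ} ∂_αw ∂_βw` of the `dt`-current
(`KerrSchild.normalCurrent G w x 0`, `KerrSchildEnergyCurrent.lean`; for the Kerr–Schild chart and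
`V = −g♯dt*` this is `T[w](V, V)`, the integrand of `Kerr.leafFlux … 0`) of `w = Re(a e^{iλφ})`:

* `GaussianBeam.timeCo G x z = ∑_ν G^{0ν}(x) z_ν` and the complex-bilinear extension
  `GaussianBeam.densC G x z w = timeCo z · timeCo w − ½ G^{00} s(z, w)` of `P⁰` (`s = symbolC`);
* `normalCurrent_zero_eq_re_densC` — **polarisation**: if `∂_νw = Re z_ν` then
  `P⁰[w] = ½ Re densC(z, z̄) + ½ Re densC(z, z)`;
* `densC_smul_smul` — homogeneity, and with `z = e^{iλφ} B` (`B = ∂a + iλ a ∂φ`,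
  `KerrSchild.dC_mul_cexp`): `densC(z, z̄) = e^{-2λ Im φ} densC(B, B̄)`,
  `densC(z, z) = e^{2iλφ} densC(B, B)` (`normalCurrent_re_beam`): the non-oscillatory part and
  the oscillatory part of the density of a real beam;
* `densC_beamB_conj` — the expansion `densC(B, B̄) = λ² |a|² densC(∂φ, ∂φ‾) +
  iλ (a densC(∂φ, ∂ā) − ā densC(∂a, ∂φ‾)) + densC(∂a, ∂ā)` and `densC_conj_eq_re_add_im`:
  `densC(ζ, ζ̄) = P⁰-form(Re ζ) + P⁰-form(Im ζ)` (the two terms `Nφ₁·nφ₁`, `Nφ₂·nφ₂` of the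
  display above).

Everything is finite-sum algebra at one point `x`; no integration.

## References

* J. Sbierski, *Characterisation of the energy of Gaussian beams on Lorentzian manifolds: with
  applications to black hole spacetimes*, Anal. PDE 8 (2015) 1379–1420, §4 (proof of the theorem)
  and the third remark after it; arXiv:1311.2477v2 §2.3, pp. 15–16 (key `Sbierski2015`).
-/

noncomputable section

open Finset Complex
open scoped ComplexConjugate

namespace Literature.Geometry.Lorentzian

namespace GaussianBeam

open KerrSchild

variable (G : E4 → Fin 4 → Fin 4 → ℝ) (x : E4)

/-! ### The complex-bilinear extension of the density -/

/-- `(G z)⁰ = ∑_ν G^{0ν}(x) z_ν` — the time component of the raised covector (for `V = −g♯dt`,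
`dw(V) = −(G dw)⁰`). [folklore] -/
def timeCo (z : Fin 4 → ℂ) : ℂ := ∑ ν : Fin 4, (G x 0 ν : ℂ) * z ν

/-- **The complex-bilinear extension of the `T(dt,dt)`-density**:
`densC(z, w) = (Gz)⁰ (Gw)⁰ − ½ G^{00} s(z, w)`. [cite: Sbierski2015, §4 (proof of the theorem)] -/
def densC (z w : Fin 4 → ℂ) : ℂ :=
  timeCo G x z * timeCo G x w - 2⁻¹ * (G x 0 0 : ℂ) * symbolC G x z w

/-- `timeCo` is additive. [folklore] -/
theorem timeCo_add (z w : Fin 4 → ℂ) : timeCo G x (z + w) = timeCo G x z + timeCo G x w := by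
  simp [timeCo, mul_add, Finset.sum_add_distrib]

/-- `timeCo` is homogeneous. [folklore] -/
theorem timeCo_smul (c : ℂ) (z : Fin 4 → ℂ) : timeCo G x (c • z) = c * timeCo G x z := by
  simp only [timeCo, Pi.smul_apply, smul_eq_mul, Finset.mul_sum]
  exact Finset.sum_congr rfl fun ν _ ↦ by ring

/-- `timeCo` commutes with conjugation (real coefficients). [folklore] -/
theorem timeCo_star (z : Fin 4 → ℂ) : timeCo G x (star z) = conj (timeCo G x z) := by
  simp [timeCo, map_sum]

/-- The symbol is homogeneous in both slots. [folklore] -/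
theorem symbolC_smul_smul (c d : ℂ) (z w : Fin 4 → ℂ) :
    symbolC G x (c • z) (d • w) = c * d * symbolC G x z w := by
  simp only [symbolC, Pi.smul_apply, smul_eq_mul, Finset.mul_sum]
  exact Finset.sum_congr rfl fun μ _ ↦ Finset.sum_congr rfl fun ν _ ↦ by ring

/-- The symbol commutes with conjugation (real coefficients). [folklore] -/
theorem symbolC_star_star (z w : Fin 4 → ℂ) :
    symbolC G x (star z) (star w) = conj (symbolC G x z w) := by
  simp [symbolC, map_sum]

/-- **Homogeneity of the density form**: `densC(c z, d w) = c d · densC(z, w)`. [folklore] -/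
theorem densC_smul_smul (c d : ℂ) (z w : Fin 4 → ℂ) :
    densC G x (c • z) (d • w) = c * d * densC G x z w := by
  simp only [densC, timeCo_smul, symbolC_smul_smul]
  ring

/-! ### Polarisation: the density of a real part -/

/-- `Re(Z Z̄) + Re(Z Z) = 2 (Re Z)²`. [folklore] -/
theorem re_mul_conj_add_re_mul_self (Z : ℂ) : (Z * conj Z).re + (Z * Z).re = 2 * Z.re ^ 2 := by
  simp [Complex.mul_re, Complex.conj_re, Complex.conj_im]
  ring

/-- `Re(g z w̄) + Re(g z w) = 2 g (Re z)(Re w)` for real `g`. [folklore] -/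
theorem re_mul_mul_conj_add (g : ℝ) (z w : ℂ) :
    ((g : ℂ) * z * conj w).re + ((g : ℂ) * z * w).re = 2 * g * z.re * w.re := by
  simp [Complex.mul_re, Complex.mul_im, Complex.conj_re, Complex.conj_im]
  ring

/-- **Polarisation of the `T(dt,dt)`-density**: if the coordinate derivatives of the real function
`w` at `x` are the real parts of `z`, then
`P⁰[w](x) = ½ Re densC(z, z̄) + ½ Re densC(z, z)` (for `z = e^{iλφ}B` the two terms are the
non-oscillatory and the oscillatory parts of the density of the real beam; third remark after
Sbierski's theorem of §4). [cite: Sbierski2015, §4 (third remark after the theorem)] -/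
theorem normalCurrent_zero_eq_re_densC {w : E4 → ℝ} {z : Fin 4 → ℂ}
    (hz : ∀ ν, fderiv ℝ w x (E4.basisVector ν) = (z ν).re) :
    normalCurrent G w x 0 = 2⁻¹ * (densC G x z (star z)).re + 2⁻¹ * (densC G x z z).re := by
  -- the raised time component
  have hT : timeCo G x (star z) = conj (timeCo G x z) := timeCo_star G x z
  have hTre : (timeCo G x z).re = ∑ ν, G x 0 ν * fderiv ℝ w x (E4.basisVector ν) := by
    simp [timeCo, Complex.re_sum, hz]
  -- the symbol
  have hS : (symbolC G x z (star z)).re + (symbolC G x z z).re =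
      2 * ∑ α, ∑ β, G x α β * fderiv ℝ w x (E4.basisVector α) * fderiv ℝ w x (E4.basisVector β) := by
    simp only [symbolC, Complex.re_sum, Pi.star_apply, Complex.star_def, ← Finset.sum_add_distrib,
      Finset.mul_sum]
    refine Finset.sum_congr rfl fun α _ ↦ Finset.sum_congr rfl fun β _ ↦ ?_
    rw [re_mul_mul_conj_add, hz, hz]
    ring
  have hP : (timeCo G x z * timeCo G x (star z)).re + (timeCo G x z * timeCo G x z).re =
      2 * (∑ ν, G x 0 ν * fderiv ℝ w x (E4.basisVector ν)) ^ 2 := by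
    rw [hT, re_mul_conj_add_re_mul_self, hTre]
  have hG00 : ∀ c : ℂ, ((2⁻¹ : ℂ) * (G x 0 0 : ℂ) * c).re = 2⁻¹ * G x 0 0 * c.re := by
    intro c
    simp [Complex.mul_re]
  have key : normalCurrent G w x 0 =
      (∑ ν, G x 0 ν * fderiv ℝ w x (E4.basisVector ν)) ^ 2 -
        2⁻¹ * G x 0 0 *
          ∑ α, ∑ β, G x α β * fderiv ℝ w x (E4.basisVector α) * fderiv ℝ w x (E4.basisVector β) := by
    unfold normalCurrent
    ring
  rw [key]
  simp only [densC, Complex.sub_re, hG00]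
  linear_combination (-2⁻¹ : ℝ) * hP + (4⁻¹ * G x 0 0) * hS

/-! ### The exponential factor -/

/-- `e^{iλφ} (e^{iλφ})‾ = e^{-2λ Im φ}`. [cite: Sbierski2015, §3 (proof of the second lemma)] -/
theorem cexp_mul_conj_cexp (lam : ℝ) (p : ℂ) :
    Complex.exp (Complex.I * lam * p) * conj (Complex.exp (Complex.I * lam * p)) =
      ((Real.exp (-2 * lam * p.im) : ℝ) : ℂ) := by
  rw [Complex.mul_conj, Complex.normSq_eq_norm_sq, norm_cexp_I_mul]
  congr 1
  rw [sq, ← Real.exp_add]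
  congr 1
  ring

/-- `(e^{iλφ})² = e^{2iλφ}`. [folklore] -/
theorem cexp_mul_cexp (lam : ℝ) (p : ℂ) :
    Complex.exp (Complex.I * lam * p) * Complex.exp (Complex.I * lam * p) =
      Complex.exp (2 * Complex.I * lam * p) := by
  rw [← Complex.exp_add]
  congr 1
  ring

/-- **The density of the real part of a beam, split into its non-oscillatory and oscillatory
parts**: if `∂_νw = Re(e^{iλφ} B_ν)` at `x` then
`P⁰[w](x) = ½ e^{-2λ Im φ} Re densC(B, B̄) + ½ Re( e^{2iλφ} densC(B, B) )`.
[cite: Sbierski2015, §4 (proof of the theorem; third remark after it)] -/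
theorem normalCurrent_re_beam {w : E4 → ℝ} {B : Fin 4 → ℂ} (lam : ℝ) (p : ℂ)
    (hz : ∀ ν, fderiv ℝ w x (E4.basisVector ν) = (Complex.exp (Complex.I * lam * p) * B ν).re) :
    normalCurrent G w x 0 =
      2⁻¹ * Real.exp (-2 * lam * p.im) * (densC G x B (star B)).re +
        2⁻¹ * (Complex.exp (2 * Complex.I * lam * p) * densC G x B B).re := by
  set E : ℂ := Complex.exp (Complex.I * lam * p) with hE
  have hz' : ∀ ν, fderiv ℝ w x (E4.basisVector ν) = ((E • B) ν).re := fun ν ↦ by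
    rw [hz ν]; rfl
  rw [normalCurrent_zero_eq_re_densC G x hz']
  have hstar : star (E • B) = (conj E) • star B := by
    ext ν; simp
  rw [hstar, densC_smul_smul, densC_smul_smul, hE, cexp_mul_conj_cexp, cexp_mul_cexp,
    Complex.re_ofReal_mul]
  ring

/-! ### Expanding `densC(B, B̄)` for `B = ∂a + iλ a ∂φ` -/

/-- `densC` is additive in the first slot. [folklore] -/
theorem densC_add_left (z z' w : Fin 4 → ℂ) :
    densC G x (z + z') w = densC G x z w + densC G x z' w := by
  have hs : symbolC G x (z + z') w = symbolC G x z w + symbolC G x z' w := by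
    simp [symbolC, add_mul, mul_add, Finset.sum_add_distrib]
  simp only [densC, timeCo_add, hs]
  ring

/-- `densC` is additive in the second slot. [folklore] -/
theorem densC_add_right (z w w' : Fin 4 → ℂ) :
    densC G x z (w + w') = densC G x z w + densC G x z w' := by
  have hs : symbolC G x z (w + w') = symbolC G x z w + symbolC G x z w' := by
    simp [symbolC, mul_add, Finset.sum_add_distrib]
  simp only [densC, timeCo_add, hs]
  ring

/-- The beam covector `B = ∂a + iλ a ∂φ`. [cite: Sbierski2015, arXiv (2.9)] -/
def beamB (lam : ℝ) (a' φ' : Fin 4 → ℂ) (a0 : ℂ) : Fin 4 → ℂ :=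
  fun ν ↦ a' ν + Complex.I * lam * a0 * φ' ν

/-- `B = ∂a + (iλa) • ∂φ` as a sum of vectors. [folklore] -/
theorem beamB_eq (lam : ℝ) (a' φ' : Fin 4 → ℂ) (a0 : ℂ) :
    beamB lam a' φ' a0 = a' + (Complex.I * lam * a0) • φ' := by
  ext ν; simp [beamB]

/-- `B̄ = ∂ā − (iλā) • ∂φ̄`. [folklore] -/
theorem star_beamB (lam : ℝ) (a' φ' : Fin 4 → ℂ) (a0 : ℂ) :
    star (beamB lam a' φ' a0) = star a' + (-(Complex.I * lam * conj a0)) • star φ' := by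
  ext ν
  simp only [beamB, Pi.star_apply, Pi.add_apply, Pi.smul_apply, smul_eq_mul, Complex.star_def,
    map_add, map_mul, Complex.conj_I, Complex.conj_ofReal]
  ring

/-- **Expansion of the non-oscillatory density** `densC(B, B̄)` for `B = ∂a + iλ a ∂φ`:
`densC(B, B̄) = λ² a ā densC(∂φ, ∂φ‾) + (iλ a densC(∂φ, ∂ā) − iλ ā densC(∂a, ∂φ‾)) + densC(∂a, ∂ā)`
(the `λ²`, `O(λ)` and `O(1)` terms of Sbierski's display).
[cite: Sbierski2015, §4 (proof of the theorem, display for `J^N(u_λ)·n`)] -/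
theorem densC_beamB_star (lam : ℝ) (a' φ' : Fin 4 → ℂ) (a0 : ℂ) :
    densC G x (beamB lam a' φ' a0) (star (beamB lam a' φ' a0)) =
      (lam : ℂ) ^ 2 * (a0 * conj a0) * densC G x φ' (star φ') +
        (Complex.I * lam * a0 * densC G x φ' (star a') -
          Complex.I * lam * conj a0 * densC G x a' (star φ')) +
        densC G x a' (star a') := by
  rw [star_beamB, beamB_eq, densC_add_left, densC_add_right, densC_add_right]
  have h1 : densC G x a' ((-(Complex.I * lam * conj a0)) • star φ') =
      (-(Complex.I * lam * conj a0)) * densC G x a' (star φ') := by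
    simpa using densC_smul_smul G x 1 (-(Complex.I * lam * conj a0)) a' (star φ')
  have h2 : densC G x ((Complex.I * lam * a0) • φ') (star a') =
      (Complex.I * lam * a0) * densC G x φ' (star a') := by
    simpa using densC_smul_smul G x (Complex.I * lam * a0) 1 φ' (star a')
  rw [h1, h2, densC_smul_smul]
  have hI : Complex.I * Complex.I = -1 := Complex.I_mul_I
  linear_combination (-(lam : ℂ) ^ 2 * a0 * conj a0 * densC G x φ' (star φ')) * hI

/-- `densC` is symmetric for symmetric coefficients. [folklore] -/
theorem densC_comm (hGs : ∀ μ ν, G x μ ν = G x ν μ) (z w : Fin 4 → ℂ) :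
    densC G x z w = densC G x w z := by
  rw [densC, densC, symbolC_comm hGs z w]
  ring

/-- Homogeneity in the first slot. [folklore] -/
theorem densC_smul_left (c : ℂ) (z w : Fin 4 → ℂ) : densC G x (c • z) w = c * densC G x z w := by
  simpa using densC_smul_smul G x c 1 z w

/-- Homogeneity in the second slot. [folklore] -/
theorem densC_smul_right (c : ℂ) (z w : Fin 4 → ℂ) : densC G x z (c • w) = c * densC G x z w := by
  simpa using densC_smul_smul G x 1 c z w

/-- On real vectors the density form is the real `P⁰`-form. [folklore] -/
theorem densC_ofReal (ξ : Fin 4 → ℝ) :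
    densC G x (fun ν ↦ (ξ ν : ℂ)) (fun ν ↦ (ξ ν : ℂ)) =
      (((∑ ν, G x 0 ν * ξ ν) * (∑ ν, G x 0 ν * ξ ν) -
        2⁻¹ * G x 0 0 * ∑ α, ∑ β, G x α β * ξ α * ξ β : ℝ) : ℂ) := by
  have hT : timeCo G x (fun ν ↦ (ξ ν : ℂ)) = ((∑ ν, G x 0 ν * ξ ν : ℝ) : ℂ) := by simp [timeCo]
  have hS : symbolC G x (fun ν ↦ (ξ ν : ℂ)) (fun ν ↦ (ξ ν : ℂ)) =
      ((∑ α, ∑ β, G x α β * ξ α * ξ β : ℝ) : ℂ) := by simp [symbolC]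
  rw [densC, hT, hS]
  push_cast
  ring

/-- On real vectors the density form is real. [folklore] -/
theorem densC_ofReal_eq_re (ξ : Fin 4 → ℝ) :
    densC G x (fun ν ↦ (ξ ν : ℂ)) (fun ν ↦ (ξ ν : ℂ)) =
      ((densC G x (fun ν ↦ (ξ ν : ℂ)) (fun ν ↦ (ξ ν : ℂ))).re : ℂ) := by
  rw [densC_ofReal, Complex.ofReal_re]

/-- **`densC(ζ, ζ̄) = P⁰(Re ζ) + P⁰(Im ζ)`** for symmetric coefficients — for `ζ = ∂φ` the two
terms `Nφ₁ · nφ₁` and `Nφ₂ · nφ₂` (with their `g(N,n)` companions) of Sbierski's display; in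
particular `densC(ζ, ζ̄)` is real. [cite: Sbierski2015, §4 (proof of the theorem)] -/
theorem densC_star_eq (hGs : ∀ μ ν, G x μ ν = G x ν μ) (ζ : Fin 4 → ℂ) :
    densC G x ζ (star ζ) =
      ((densC G x (fun ν ↦ ((ζ ν).re : ℂ)) (fun ν ↦ ((ζ ν).re : ℂ))).re : ℂ) +
        ((densC G x (fun ν ↦ ((ζ ν).im : ℂ)) (fun ν ↦ ((ζ ν).im : ℂ))).re : ℂ) := by
  set r : Fin 4 → ℂ := fun ν ↦ ((ζ ν).re : ℂ) with hr
  set s : Fin 4 → ℂ := fun ν ↦ ((ζ ν).im : ℂ) with hs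
  have hζ : ζ = r + Complex.I • s := by
    ext ν
    simp only [hr, hs, Pi.add_apply, Pi.smul_apply, smul_eq_mul]
    rw [mul_comm, Complex.re_add_im]
  have hζs : star ζ = r + (-Complex.I) • s := by
    ext ν
    simp only [hr, hs, Pi.star_apply, Pi.add_apply, Pi.smul_apply, smul_eq_mul, Complex.star_def]
    apply Complex.ext <;> simp
  rw [hζs]
  conv_lhs => rw [hζ]
  rw [densC_add_left, densC_add_right, densC_add_right, densC_smul_left, densC_smul_left,
    densC_smul_right, densC_smul_right, densC_comm G x hGs s r, ← densC_ofReal_eq_re,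
    ← densC_ofReal_eq_re]
  have hI : Complex.I * Complex.I = -1 := Complex.I_mul_I
  linear_combination (-densC G x s s) * hI

end GaussianBeam

end Literature.Geometry.Lorentzian
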